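import Summits.ABC.StewartYu.PadicG3VbSizes
import HarnessLib

/-!
# Cell abc-stewartyu, crux `Y07Odd` (stmt-ABC-19658), `m = 0` branch: the sizes of the START entry bound `AmaxS₂`, the Siegel coefficient
# bound `PmaxS₂` and the k-step Liouville constant `KC` at the record schedule `P.schedVb b`

`Summits/ABC/StewartYu/PadicG3VbSizesB.lean` — cell `abc-stewartyu` (seat p3-g7).  Theorems only, no named fact.  Continues `PadicG3VbSizes`:
with `T₀ʳ := (69/4)(n+1)·LgV ≥ TordS Sc 0 0`, `c_A := ŜG·log 2 + (43/20)·HV + 2·log n`, `c_τ := ŜG·log 2 + (23/20)·HV + 2·log n`,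
`AV⁺ := L0V·(ŜG+n+6)·log 2`:
* `log AmaxS₂ Sc ≤ log 2 + T₀ʳ·c_A + HV/e + AV⁺ + 2·htsV 0`;
* `log PmaxS₂ Sc ≤ log 2 + lunkV + (that)`;
* for every k-step target (`lev ≤ ŜG`, stage `ν + 1 ≤ n`, node `|x₁| ≤ NS Sc lev (ν+1)`, order `|τ| ≤ TordS Sc 0 0`):
  `log KC(UcardS₂, PmaxS₂, L0V, HV, ŜG, lev, Lb lev, x₁, τ) ≤ 4 log 2 + 2 lunkV + T₀ʳ·(c_A + c_τ) + 2 HV/e + 2 AV⁺ + 2 htsV 0 + 4 htsV ν`.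

References: Yu. V. Nesterenko, LNM 1819 (2003) Prop. 3.9 (3.40), §4.2 (4.34)–(4.35).
-/

noncomputable section

open Finset Real
open Literature.NumberTheory.Transcendental
open Literature.NumberTheory.Transcendental.CW77.Setup (Tau tauNorm)

namespace Summit.ABC.StewartYu

namespace G3Setup

variable {p : ℕ} [Fact p.Prime] (S : G3Setup p) (P : PadicG3Par S.n) (b : ℝ)

/-- `log XbSS₂ ≤ log 2 + 2 log n + W + log LV ≤ HV + 2 log n` at `schedVb`. [folklore] -/
theorem log_XbSS₂_Vb_le (hb : 1 ≤ b) (hn : 1 ≤ S.n) (hA1 : ∀ j, 1 ≤ P.A j) (hbW : ∀ j, Real.log (max 3 (|S.b j| : ℝ)) ≤ P.W) :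
    Real.log (S.XbSS₂ (P.schedVb b) : ℝ) ≤ P.HV + 2 * Real.log S.n := by
  have h := S.XbSS₂_Vb_le P b hb hn hA1 hbW
  have h1 : (1 : ℝ) ≤ (S.XbSS₂ (P.schedVb b) : ℝ) := by
    have : (1 : ℤ) ≤ S.XbSS₂ (P.schedVb b) := by unfold XbSS₂; exact le_max_left _ _
    exact_mod_cast this
  have hlog : Real.log (S.XbSS₂ (P.schedVb b) : ℝ) ≤ Real.log 2 + 2 * Real.log S.n + P.W + Real.log P.LV := by
    have := Real.log_le_log (by linarith) h
    rwa [Real.log_exp] at this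
  have hHV := P.W_log_LV_le_HV
  linarith

/-- **The START entry bound**: `log AmaxS₂ ≤ log 2 + T₀ʳ·c_A + HV/e + AV⁺ + 2·htsV 0`. [cite: Nesterenko2003, Prop 3.9 (3.40); shape only] -/
theorem log_AmaxS₂_Vb_le (hb : 1 ≤ b) (hn : 1 ≤ S.n) (hA1 : ∀ j, 1 ≤ P.A j)
    (hαA : ∀ j, Height.logHeight₁ (S.α j) ≤ P.A j) (hbW : ∀ j, Real.log (max 3 (|S.b j| : ℝ)) ≤ P.W) :
    Real.log (S.AmaxS₂ (P.schedVb b)) ≤ Real.log 2 +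
      (69 / 4) * (S.n + 1) * P.LgV * (P.SdG * Real.log 2 + 43 / 20 * P.HV + 2 * Real.log S.n) + P.HV / Real.exp 1 +
      P.L0V * ((P.SdG + S.n + 6) * Real.log 2) + 2 * P.htsV 0 := by
  -- names
  set X₀ : ℕ := S.NS (P.schedVb b) 0 0 with hX₀
  set T₀ : ℕ := S.TordS (P.schedVb b) 0 0 with hT₀
  have hT₀r : (T₀ : ℝ) ≤ (69 / 4) * (S.n + 1) * P.LgV := S.TordS_Vb_zero_real_le P b
  have hT₀0 : (0 : ℝ) ≤ T₀ := Nat.cast_nonneg _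
  -- the three factors
  have hMpos := M0C_pos P.L0V P.HV P.SdG 0 (X₀ : ℤ) T₀
  have hX1 : (1 : ℝ) ≤ (S.XbSS₂ (P.schedVb b) : ℝ) := by
    have : (1 : ℤ) ≤ S.XbSS₂ (P.schedVb b) := by unfold XbSS₂; exact le_max_left _ _
    exact_mod_cast this
  have hD1 : (1 : ℝ) ≤ (MonomialDen.monDen S.α (S.boxExpG (S.Lb (S.sideS₂ (P.schedVb b)) 0) (X₀ : ℤ)) : ℝ) := by
    exact_mod_cast MonomialDen.one_le_monDen _ S.α_ne _
  -- log of the product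
  have hA : S.AmaxS₂ (P.schedVb b) = (M0C P.L0V P.HV P.SdG 0 (X₀ : ℤ) T₀ : ℝ) * (S.XbSS₂ (P.schedVb b) : ℝ) ^ T₀ *
      ((MonomialDen.monDen S.α (S.boxExpG (S.Lb (S.sideS₂ (P.schedVb b)) 0) (X₀ : ℤ)) : ℝ)) ^ 2 := rfl
  rw [hA, Real.log_mul (by positivity) (by positivity), Real.log_mul hMpos.ne' (by positivity), Real.log_pow, Real.log_pow]
  -- M0C
  have hx : (|((X₀ : ℕ) : ℤ)| : ℝ) ≤ 2 ^ (0 + S.n) * (9 * P.HV) := by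
    have h := S.NS00_Vb_le_HV P b
    push_cast; rw [abs_of_nonneg (by positivity)]; exact h
  have hM := log_M0C_le_sharp P.L0V P.HV P.SdG 0 (X₀ : ℤ) T₀
  have hL := S.L0_factor_Vb_le P (Nat.zero_le _) hx
  simp only [Nat.sub_zero] at hM hL
  -- XbSS
  have hXb := S.log_XbSS₂_Vb_le P b hb hn hA1 hbW
  -- monDen
  have hmon : Real.log (MonomialDen.monDen S.α (S.boxExpG (S.Lb (S.sideS₂ (P.schedVb b)) 0) (X₀ : ℤ)) : ℝ) ≤ P.htsV 0 := by
    have h1 := S.log_monDen_box_Vb_le P b hb hαA 0 (X₀ : ℤ)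
    have h2 := S.start_height_Vb_le P b
    rw [← hX₀] at h2
    push_cast at h1
    rw [abs_of_nonneg (by positivity), pow_zero, div_one] at h1
    linarith
  -- assemble
  have hHV : (0 : ℝ) ≤ P.HV := by positivity
  have hSd : (0 : ℝ) ≤ P.SdG * Real.log 2 := mul_nonneg (Nat.cast_nonneg _) (Real.log_nonneg (by norm_num))
  have hlogn : (0 : ℝ) ≤ Real.log S.n := Real.log_nonneg (by exact_mod_cast hn)
  have hcoef : (0 : ℝ) ≤ P.SdG * Real.log 2 + 43 / 20 * P.HV + 2 * Real.log S.n := by positivity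
  have key : (T₀ : ℝ) * (P.SdG * Real.log 2 + 23 / 20 * P.HV) + T₀ * (P.HV + 2 * Real.log S.n) ≤
      (69 / 4) * (S.n + 1) * P.LgV * (P.SdG * Real.log 2 + 43 / 20 * P.HV + 2 * Real.log S.n) := by
    have : (T₀ : ℝ) * (P.SdG * Real.log 2 + 23 / 20 * P.HV) + T₀ * (P.HV + 2 * Real.log S.n) =
        T₀ * (P.SdG * Real.log 2 + 43 / 20 * P.HV + 2 * Real.log S.n) := by ring
    rw [this]
    exact mul_le_mul_of_nonneg_right hT₀r hcoef
  nlinarith [mul_le_mul_of_nonneg_left hXb hT₀0, key, hM, hL, hmon]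

/-- `1 ≤ PmaxS₂` and `PmaxS₂ ≤ 2·UcardS₂·AmaxS₂`. [folklore] -/
theorem PmaxS₂_le_two_mul (Sc : G3Sched S.n) : (1 : ℝ) ≤ (S.PmaxS₂ Sc : ℝ) ∧ (S.PmaxS₂ Sc : ℝ) ≤ 2 * ((S.UcardS₂ Sc : ℝ) * S.AmaxS₂ Sc) := by
  have hU : (1 : ℝ) ≤ (S.UcardS₂ Sc : ℝ) := by exact_mod_cast S.one_le_UcardS₂ Sc
  have hA := S.one_le_AmaxS₂ Sc
  have hUA : (1 : ℝ) ≤ (S.UcardS₂ Sc : ℝ) * S.AmaxS₂ Sc := by nlinarith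
  constructor
  · have : (1 : ℤ) ≤ S.PmaxS₂ Sc := by unfold PmaxS₂; exact Int.one_le_ceil_iff.mpr (by linarith)
    exact_mod_cast this
  · unfold PmaxS₂
    have h := Int.ceil_lt_add_one ((S.UcardS₂ Sc : ℝ) * S.AmaxS₂ Sc)
    linarith

/-- **The Siegel coefficient bound**: `log PmaxS₂ ≤ log 2 + lunkV + (log 2 + T₀ʳ·c_A + HV/e + AV⁺ + 2·htsV 0)`. [folklore] -/
theorem log_PmaxS₂_Vb_le (hb : 1 ≤ b) (hn : 1 ≤ S.n) (hA1 : ∀ j, 1 ≤ P.A j)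
    (hαA : ∀ j, Height.logHeight₁ (S.α j) ≤ P.A j) (hbW : ∀ j, Real.log (max 3 (|S.b j| : ℝ)) ≤ P.W) :
    Real.log (S.PmaxS₂ (P.schedVb b) : ℝ) ≤ Real.log 2 + P.lunkV + (Real.log 2 +
      (69 / 4) * (S.n + 1) * P.LgV * (P.SdG * Real.log 2 + 43 / 20 * P.HV + 2 * Real.log S.n) + P.HV / Real.exp 1 +
      P.L0V * ((P.SdG + S.n + 6) * Real.log 2) + 2 * P.htsV 0) := by
  obtain ⟨h1, h2⟩ := S.PmaxS₂_le_two_mul (P.schedVb b)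
  have hU : (1 : ℝ) ≤ (S.UcardS₂ (P.schedVb b) : ℝ) := by exact_mod_cast S.one_le_UcardS₂ (P.schedVb b)
  have hA := S.one_le_AmaxS₂ (P.schedVb b)
  have hlog : Real.log (S.PmaxS₂ (P.schedVb b) : ℝ) ≤ Real.log 2 + Real.log (S.UcardS₂ (P.schedVb b) : ℝ) + Real.log (S.AmaxS₂ (P.schedVb b)) := by
    rw [← Real.log_mul (by norm_num) (by positivity), ← Real.log_mul (by positivity) (by positivity)]
    exact Real.log_le_log (by linarith) (by linarith)
  have hUl := S.log_UcardS₂_Vb_le P b hb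
  have hAl := S.log_AmaxS₂_Vb_le P b hb hn hA1 hαA hbW
  linarith

/-- **The k-step Liouville constant** at an admissible target of stage `ν`:
`log KC ≤ 4 log 2 + 2 lunkV + T₀ʳ·(c_A + c_τ) + 2·HV/e + 2·AV⁺ + 2·htsV 0 + 4·htsV ν`. [cite: Nesterenko2003, (4.34)–(4.35); shape only] -/
theorem log_KC_Vb_le (hb : 1 ≤ b) (hn : 1 ≤ S.n) (hA1 : ∀ j, 1 ≤ P.A j)
    (hαA : ∀ j, Height.logHeight₁ (S.α j) ≤ P.A j) (hbW : ∀ j, Real.log (max 3 (|S.b j| : ℝ)) ≤ P.W)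
    {lev ν : ℕ} (hlev : lev ≤ P.SdG) (hν : ν + 1 ≤ S.n) {x₁ : ℤ} (hx : |x₁| ≤ (S.NS (P.schedVb b) lev (ν + 1) : ℤ))
    (τ : Tau S.n) (hτ : tauNorm τ ≤ S.TordS (P.schedVb b) 0 0) :
    Real.log (S.KC (S.UcardS₂ (P.schedVb b)) (S.PmaxS₂ (P.schedVb b)) P.L0V P.HV P.SdG lev (S.Lb (S.sideS₂ (P.schedVb b)) lev) x₁ τ) ≤
      4 * Real.log 2 + 2 * P.lunkV +
      (69 / 4) * (S.n + 1) * P.LgV * ((P.SdG * Real.log 2 + 43 / 20 * P.HV + 2 * Real.log S.n) + (P.SdG * Real.log 2 + 23 / 20 * P.HV + 2 * Real.log S.n)) +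
      2 * (P.HV / Real.exp 1) + 2 * (P.L0V * ((P.SdG + S.n + 6) * Real.log 2)) + 2 * P.htsV 0 + 4 * P.htsV ν := by
  -- signs
  have hl2 : 0 ≤ Real.log 2 := Real.log_nonneg (by norm_num)
  have hlogn : (0 : ℝ) ≤ Real.log S.n := Real.log_nonneg (by exact_mod_cast hn)
  have hHV : (0 : ℝ) ≤ P.HV := by positivity
  have hLgV : (0 : ℝ) ≤ P.LgV := by positivity
  have hL0 : (0 : ℝ) ≤ P.L0V := by positivity
  have hhts0 := P.htsV_nonneg 0
  have hhts := P.htsV_nonneg ν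
  obtain ⟨_, _, _, hlunk0⟩ := P.piecesV_nonneg
  have hcτ0 : (0 : ℝ) ≤ P.SdG * Real.log 2 + 23 / 20 * P.HV + 2 * Real.log S.n := by positivity
  have hcA0 : (0 : ℝ) ≤ P.SdG * Real.log 2 + 43 / 20 * P.HV + 2 * Real.log S.n := by positivity
  have hT0r0 : (0 : ℝ) ≤ (69 / 4) * (S.n + 1) * P.LgV := by positivity
  -- the five factors
  have hU1 : (1 : ℝ) ≤ (S.UcardS₂ (P.schedVb b) : ℝ) := by exact_mod_cast S.one_le_UcardS₂ (P.schedVb b)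
  have hUexp : (S.UcardS₂ (P.schedVb b) : ℝ) ≤ Real.exp P.lunkV := by
    rw [← Real.exp_log (by linarith : (0 : ℝ) < S.UcardS₂ (P.schedVb b))]
    exact Real.exp_le_exp.mpr (S.log_UcardS₂_Vb_le P b hb)
  obtain ⟨hP1, _⟩ := S.PmaxS₂_le_two_mul (P.schedVb b)
  have hPexp : (S.PmaxS₂ (P.schedVb b) : ℝ) ≤ Real.exp (Real.log 2 + P.lunkV + (Real.log 2 +
      (69 / 4) * (S.n + 1) * P.LgV * (P.SdG * Real.log 2 + 43 / 20 * P.HV + 2 * Real.log S.n) + P.HV / Real.exp 1 +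
      P.L0V * ((P.SdG + S.n + 6) * Real.log 2) + 2 * P.htsV 0)) := by
    rw [← Real.exp_log (by linarith : (0 : ℝ) < S.PmaxS₂ (P.schedVb b))]
    exact Real.exp_le_exp.mpr (S.log_PmaxS₂_Vb_le P b hb hn hA1 hαA hbW)
  have hxr : (|x₁| : ℝ) ≤ 2 ^ (lev + S.n) * (9 * P.HV) := by
    have h1 : ((|x₁| : ℤ) : ℝ) ≤ ((S.NS (P.schedVb b) lev (ν + 1) : ℤ) : ℝ) := by exact_mod_cast hx
    push_cast at h1
    exact h1.trans (S.NS_Vb_le_HV P b hν)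
  have hMexp := S.M0C_Vb_le_exp P hlev hxr τ.1
  have hXexp := S.XbC_pow_Vb_le P b hb hn hA1 hbW lev (∑ k, τ.2 k)
  have hD1 : (1 : ℝ) ≤ (MonomialDen.monDen S.α (S.boxExpG (S.Lb (S.sideS₂ (P.schedVb b)) lev) x₁) : ℝ) := by
    exact_mod_cast MonomialDen.one_le_monDen _ S.α_ne _
  have hDexp : ((MonomialDen.monDen S.α (S.boxExpG (S.Lb (S.sideS₂ (P.schedVb b)) lev) x₁) : ℝ)) ^ 2 ≤ Real.exp (4 * P.htsV ν) := by
    have h1 := S.log_monDen_box_Vb_le P b hb hαA lev x₁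
    have h2 := S.nodes_height_Vb_le P b lev ν
    have hx' : |(x₁ : ℝ)| ≤ (S.NS (P.schedVb b) lev (ν + 1) : ℝ) := by
      have : ((|x₁| : ℤ) : ℝ) ≤ ((S.NS (P.schedVb b) lev (ν + 1) : ℤ) : ℝ) := by exact_mod_cast hx
      push_cast at this; exact this
    have hlog : Real.log (MonomialDen.monDen S.α (S.boxExpG (S.Lb (S.sideS₂ (P.schedVb b)) lev) x₁) : ℝ) ≤ 2 * P.htsV ν := by
      have h0 : (0 : ℝ) ≤ S.n * P.LV / 2 ^ lev := by positivity
      nlinarith [mul_le_mul_of_nonneg_right hx' h0]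
    rw [← Real.exp_log (by linarith : (0 : ℝ) < (MonomialDen.monDen S.α (S.boxExpG (S.Lb (S.sideS₂ (P.schedVb b)) lev) x₁) : ℝ)),
      ← Real.exp_nat_mul]
    exact Real.exp_le_exp.mpr (by push_cast; linarith)
  -- the order budget of the target
  have hτsum : (τ.1 : ℝ) * (P.SdG * Real.log 2 + 23 / 20 * P.HV) +
      ((∑ k, τ.2 k : ℕ) : ℝ) * (Real.log 2 + 2 * Real.log S.n + P.W + Real.log P.LV) ≤
      (69 / 4) * (S.n + 1) * P.LgV * (P.SdG * Real.log 2 + 23 / 20 * P.HV + 2 * Real.log S.n) := by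
    have hW := P.W_log_LV_le_HV
    have hτr : ((τ.1 : ℝ) + ((∑ k, τ.2 k : ℕ) : ℝ)) ≤ (69 / 4) * (S.n + 1) * P.LgV := by
      have : ((tauNorm τ : ℕ) : ℝ) ≤ (S.TordS (P.schedVb b) 0 0 : ℝ) := by exact_mod_cast hτ
      unfold tauNorm at this; rw [Nat.cast_add] at this
      exact this.trans (S.TordS_Vb_zero_real_le P b)
    have ht1 : (0 : ℝ) ≤ τ.1 := Nat.cast_nonneg _
    have ht2 : (0 : ℝ) ≤ ((∑ k, τ.2 k : ℕ) : ℝ) := Nat.cast_nonneg _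
    have hSd : (0 : ℝ) ≤ P.SdG * Real.log 2 := by positivity
    calc (τ.1 : ℝ) * (P.SdG * Real.log 2 + 23 / 20 * P.HV) + ((∑ k, τ.2 k : ℕ) : ℝ) * (Real.log 2 + 2 * Real.log S.n + P.W + Real.log P.LV)
        ≤ τ.1 * (P.SdG * Real.log 2 + 23 / 20 * P.HV + 2 * Real.log S.n) +
            ((∑ k, τ.2 k : ℕ) : ℝ) * (P.SdG * Real.log 2 + 23 / 20 * P.HV + 2 * Real.log S.n) :=
          add_le_add (mul_le_mul_of_nonneg_left (by linarith) ht1) (mul_le_mul_of_nonneg_left (by linarith) ht2)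
      _ = ((τ.1 : ℝ) + ((∑ k, τ.2 k : ℕ) : ℝ)) * (P.SdG * Real.log 2 + 23 / 20 * P.HV + 2 * Real.log S.n) := by ring
      _ ≤ _ := mul_le_mul_of_nonneg_right hτr hcτ0
  -- the product `y ≤ exp E`
  have hM0 := (M0C_pos P.L0V P.HV P.SdG lev x₁ τ.1).le
  have hX0 : (0 : ℝ) ≤ (S.XbC (S.Lb (S.sideS₂ (P.schedVb b)) lev) : ℝ) ^ (∑ k, τ.2 k) := pow_nonneg (S.XbC_nonneg _) _
  have hP0 : (0 : ℝ) ≤ (S.PmaxS₂ (P.schedVb b) : ℝ) := by linarith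
  have hy : (S.UcardS₂ (P.schedVb b) : ℝ) * (S.PmaxS₂ (P.schedVb b) : ℝ) *
      ((M0C P.L0V P.HV P.SdG lev x₁ τ.1 : ℝ) * (S.XbC (S.Lb (S.sideS₂ (P.schedVb b)) lev) : ℝ) ^ (∑ k, τ.2 k) *
        ((MonomialDen.monDen S.α (S.boxExpG (S.Lb (S.sideS₂ (P.schedVb b)) lev) x₁) : ℝ)) ^ 2) ≤
      Real.exp P.lunkV * Real.exp (Real.log 2 + P.lunkV + (Real.log 2 +
        (69 / 4) * (S.n + 1) * P.LgV * (P.SdG * Real.log 2 + 43 / 20 * P.HV + 2 * Real.log S.n) + P.HV / Real.exp 1 +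
        P.L0V * ((P.SdG + S.n + 6) * Real.log 2) + 2 * P.htsV 0)) *
      (Real.exp (Real.log 2 + τ.1 * (P.SdG * Real.log 2 + 23 / 20 * P.HV) + P.HV / Real.exp 1 + P.L0V * ((P.SdG + S.n + 6) * Real.log 2)) *
        Real.exp (((∑ k, τ.2 k : ℕ) : ℝ) * (Real.log 2 + 2 * Real.log S.n + P.W + Real.log P.LV)) * Real.exp (4 * P.htsV ν)) := by
    gcongr
  rw [← Real.exp_add, ← Real.exp_add, ← Real.exp_add, ← Real.exp_add] at hy
  -- `KC = 1 + y ≤ 2·exp(E')` with `E ≤ E'`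
  have hKCpos : 0 < S.KC (S.UcardS₂ (P.schedVb b)) (S.PmaxS₂ (P.schedVb b)) P.L0V P.HV P.SdG lev (S.Lb (S.sideS₂ (P.schedVb b)) lev) x₁ τ := by
    unfold KC; positivity
  have hKC : S.KC (S.UcardS₂ (P.schedVb b)) (S.PmaxS₂ (P.schedVb b)) P.L0V P.HV P.SdG lev (S.Lb (S.sideS₂ (P.schedVb b)) lev) x₁ τ ≤
      2 * Real.exp (3 * Real.log 2 + 2 * P.lunkV +
      (69 / 4) * (S.n + 1) * P.LgV * ((P.SdG * Real.log 2 + 43 / 20 * P.HV + 2 * Real.log S.n) + (P.SdG * Real.log 2 + 23 / 20 * P.HV + 2 * Real.log S.n)) +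
      2 * (P.HV / Real.exp 1) + 2 * (P.L0V * ((P.SdG + S.n + 6) * Real.log 2)) + 2 * P.htsV 0 + 4 * P.htsV ν) := by
    unfold KC
    have hsum : P.lunkV + (Real.log 2 + P.lunkV + (Real.log 2 +
        (69 / 4) * (S.n + 1) * P.LgV * (P.SdG * Real.log 2 + 43 / 20 * P.HV + 2 * Real.log S.n) + P.HV / Real.exp 1 +
        P.L0V * ((P.SdG + S.n + 6) * Real.log 2) + 2 * P.htsV 0)) +
        ((Real.log 2 + τ.1 * (P.SdG * Real.log 2 + 23 / 20 * P.HV) + P.HV / Real.exp 1 + P.L0V * ((P.SdG + S.n + 6) * Real.log 2)) +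
          (((∑ k, τ.2 k : ℕ) : ℝ) * (Real.log 2 + 2 * Real.log S.n + P.W + Real.log P.LV)) + (4 * P.htsV ν)) ≤
        (3 * Real.log 2 + 2 * P.lunkV +
      (69 / 4) * (S.n + 1) * P.LgV * ((P.SdG * Real.log 2 + 43 / 20 * P.HV + 2 * Real.log S.n) + (P.SdG * Real.log 2 + 23 / 20 * P.HV + 2 * Real.log S.n)) +
      2 * (P.HV / Real.exp 1) + 2 * (P.L0V * ((P.SdG + S.n + 6) * Real.log 2)) + 2 * P.htsV 0 + 4 * P.htsV ν) := by
      linarith [hτsum]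
    have hE := hy.trans (Real.exp_le_exp.mpr hsum)
    have h1 : (1 : ℝ) ≤ Real.exp (3 * Real.log 2 + 2 * P.lunkV +
      (69 / 4) * (S.n + 1) * P.LgV * ((P.SdG * Real.log 2 + 43 / 20 * P.HV + 2 * Real.log S.n) + (P.SdG * Real.log 2 + 23 / 20 * P.HV + 2 * Real.log S.n)) +
      2 * (P.HV / Real.exp 1) + 2 * (P.L0V * ((P.SdG + S.n + 6) * Real.log 2)) + 2 * P.htsV 0 + 4 * P.htsV ν) :=
      Real.one_le_exp (by positivity)
    linarith
  calc Real.log (S.KC (S.UcardS₂ (P.schedVb b)) (S.PmaxS₂ (P.schedVb b)) P.L0V P.HV P.SdG lev (S.Lb (S.sideS₂ (P.schedVb b)) lev) x₁ τ)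
      ≤ Real.log (2 * Real.exp (3 * Real.log 2 + 2 * P.lunkV +
      (69 / 4) * (S.n + 1) * P.LgV * ((P.SdG * Real.log 2 + 43 / 20 * P.HV + 2 * Real.log S.n) + (P.SdG * Real.log 2 + 23 / 20 * P.HV + 2 * Real.log S.n)) +
      2 * (P.HV / Real.exp 1) + 2 * (P.L0V * ((P.SdG + S.n + 6) * Real.log 2)) + 2 * P.htsV 0 + 4 * P.htsV ν)) := Real.log_le_log hKCpos hKC
    _ = _ := by rw [Real.log_mul (by norm_num) (Real.exp_pos _).ne', Real.log_exp]; ring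

end G3Setup

end Summit.ABC.StewartYu

end
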